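import Summits.QuantumFields.BalabanUV.Beta.GAN24.SubAveragingKernel
import Summits.QuantumFields.BalabanUV.Beta.FP.CoarseCovarianceSymbol

/-!
# `BalabanUV.Beta.GAN24.SubAveragingMinimiser` — binder row G-an2-4 ∕ (CONV-C), programme «SUBAVG-H», FILE A (fibre level):
# THE SCALAR HARD-CONSTRAINT MINIMISER `H_k = 𝒢Q_k^*(Q_k𝒢Q_k^*)⁻¹` (B5 (1.103), massless, `U = 1`, whole fine lattice) BY THE
# WOODBURY ∕ PUSH-THROUGH FACTORISATION `H_k = (G₁Q_k^*)·(1 + Δ_k^{eff})`, AND ITS SUB-AVERAGED ONE-STEP RATE `θ = L⁻²` ON THE FAT REGION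

NOT IN PRINT; OUR PROOF ATTEMPT (prover part P3 of row G-an2-4, fibre∕strip («Woodbury») lineage, gen 23; CRUX TEAM (2), ruling «YM
REDIRECT TOWARDS THE SUMMIT», 2026-08-21).  HONEST DEPENDENCY (cell records, verbatim): «continuum YM on T⁴ ⇐ BetaPertH ∧ nine spine
estimates (0/9 proved); BetaPertH ⇐ (D1) ∧ (D4) ∧ CAP+tail; G-an2-4 gates asym, D1 and NE2/3/4.»  HONEST FRAMING (cell contract,
verbatim): «discharging `BetaPertH` makes Bałaban's UV stability UNCONDITIONAL — a real constructive-QFT result; it is NOT the continuum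
limit and NOT the Clay problem.»  ABSOLUTE RULE: nothing printed is a hypothesis.  [folklore] algebra and estimates over TREE modules BY
NAME: gen 22's `GAN24/SubAveraging{Kernel,FibreColumn,Fibre}` (the soft column `G_jQ_j^*` of B4 (2.48): `avgG`, `Dmult`, `norm_Dmult_le`,
`norm_E_sub_E_le`, `norm_DeltaXi_mul_sub_le`), `B4StripSums` (`G`, `F`, `R`, `norm_G_le`, `boundG`), `B4StripCauchy` (`Fat`,
`norm_DeltaXi_le`) and road FP's `FP/CoarseCovarianceSymbol` (leaf-06: the GK inverse coarse symbol `Δ^ξ∕(E(1,0) − Δ^ξ)`,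
`F_eq_DeltaXi_mul`).  No `def … : Prop`, no sorry; four [folklore] object definitions (`Leff`, `Hm`, `avgHm`, `DmultH`) and two constants.

## The species (so that no consumer over-reads this file)

B5 (1.103) p. 34: «so finally we get the representation H_kB = GQ*(QGQ*)⁻¹B» — here in the SCALAR sector (plain block averaging `Q_k`,
no gauge condition), MASSLESS, on the WHOLE fine lattice `(1∕n)ℤ^{d}` over the unit lattice (`n = L^k` arbitrary `≥ 1`), at `U = 1`; the
tree holds this object in position space as `B5Hk103ScalarZd.kerH` (thermodynamic limits of inverses, mesh-free decay, `Q′H = I`) — the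
identification of the two constructions is NOT proved here.  It is NOT gen 22's soft column `G_jQ_j^*` of B4 (2.48) (`a < ∞`, `m² ≥ 0`), NOT
road P2's unit-lattice covariance `C^{(k)}(𝟙)`, NOT the vector `H_k` of B5 (1.63) (`T4Hk163StripRate`: rate `η¹`, injection currency).

## The mechanism (the lineage's Woodbury idea, used for a RATE)

Push-through: `(Δ^ξ + aQ*Q)⁻¹Q* = 𝒢Q*(1 + aQ𝒢Q*)⁻¹`, `𝒢 = (Δ^ξ)⁻¹`; with `Δ^{eff} := (Q𝒢Q*)⁻¹` (Bałaban's (1.65) effective Laplacian,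
scalar) this reads `G_aQ* = H·(Δ^{eff} + a)⁻¹`, i.e. **`H = (G₁Q*)·(1 + Δ^{eff})`** at `a = 1`.  Fibrewise at unit momentum `p′`:
`Δ^{eff}(p′) = 1∕Σ_l |u(p′+l)|²∕Δ^ξ(p′+l) = Δ^ξ(p′)∕(E(1,0)(p′) − Δ^ξ(p′))` in the tree's REGROUPED letters (`E` = B4's zero-free
denominator; `CoarseCovarianceSymbol.invSymbol_eq`), holomorphic and `n`-uniformly bounded on a `d`-only strip (`F_lower`).  So
  `Hm n τ := G n 1 0 τ · (1 + Leff n)`  (definition §1; `Hm_eq_sum`: `= Σ_k F(τ,k)·R_k ∕ (E(1,0) − Δ^ξ)`; `Hm_eq_printed`: `= Σ_k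
  e^{i(p′+2πk)·τ∕n} u(p′+2πk)∕Δ^ξ(p′+2πk) ∕ Σ_j |u(p′+2πj)|²∕Δ^ξ(p′+2πj)` — the printed `𝒢Q*(Q𝒢Q*)⁻¹` alias by alias),
and the sub-cell average of the finer column minus the coarser one splits EXACTLY (`DmultH_eq`) as
  `avgHm(nL) − Hm(n) = Dmult(n,L;1,0)·(1 + Leff(nL)) + G(n;1,0)·(Leff(nL) − Leff(n))`,
whose pieces are gen 22's `‖Dmult‖ ≤ HF·Ccol∕n²`, `‖1 + Leff‖ ≤ 1 + 16d∕c_F`, `‖G‖ ≤ boundG`, and (§3) `‖Leff(nL) − Leff(n)‖ ≤ CL∕n²`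
(from `‖Δ^{ξ∕L} − Δ^ξ‖ ≤ 512d∕n²` and `‖E(nL) − E(n)‖ ≤ CE∕n²`).  **`norm_DmultH_le`: `‖avgHm − Hm‖ ≤ CH(n)∕n²`** on the fat region,
`CH(n) = HF(n)·Ccol·(1 + 16d∕c_F) + boundG·CL` (`HF ≍ (48 log n)^d` is the entrywise alias weight; the block currencies of FILE C are `n`-free).

NOT HERE: strip regularity, kernels, the END (FILE B `SubAveragingMinimiserKernel`); the unit-read two clauses (FILE C).  NOT the vector
case, NOT composites, NOT `U ≠ 1`.  NEVER «G-an2-4 closed»; NOT D1, NOT BetaPertH, NOT continuum, NOT Clay.  Provenance: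
prover-b2b-balaban-gan24-p3-g23-0 (unit `b2b-balaban-gan24-p3`, gen 23), 2026-08-21.
-/

noncomputable section

namespace Summit.QuantumFields.BalabanUV.Beta.GAN24.SubAveragingMinimiser

open Complex Finset
open Literature.MathematicalPhysics.QuantumFieldTheory.Balaban1983to89
open Literature.MathematicalPhysics.QuantumFieldTheory.Balaban1983to89.B4Strip
open Literature.MathematicalPhysics.QuantumFieldTheory.Balaban1983to89.B4StripCauchy
open Literature.MathematicalPhysics.QuantumFieldTheory.Balaban1983to89.B4StripSums
open Summit.QuantumFields.BalabanUV.Beta.GAN24.SubAveragingFibre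
open Summit.QuantumFields.BalabanUV.Beta.GAN24.SubAveragingFibreColumn
open Summit.QuantumFields.BalabanUV.Beta.GAN24.SubAveragingKernel
open Summit.QuantumFields.BalabanUV.Beta.FP
open scoped Real

variable {d : ℕ}

/-! ## §1 The objects: the effective-Laplacian symbol, the hard minimiser column, the dictionaries -/

/-- [folklore] THE SCALAR EFFECTIVE-LAPLACIAN SYMBOL `Δ^{eff}_k(p′) = (Q_k𝒢Q_k^*)^(p′)⁻¹` in regrouped, strip-holomorphic form:
`Δ^ξ(p′)∕(E n 1 0 p′ − Δ^ξ(p′))` (road FP leaf-06's GK inverse coarse symbol, `CoarseCovarianceSymbol`). -/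
def Leff (n : ℕ) [NeZero n] (p : Fin d → ℂ) : ℂ := DeltaXi n 0 p / (E n 1 0 p - DeltaXi n 0 p)

/-- [folklore] **THE FOURIER MULTIPLIER OF THE HARD MINIMISER COLUMN** `(H_kB)(y + τ∕n)`, `H_k = 𝒢Q_k^*(Q_k𝒢Q_k^*)⁻¹` (B5 (1.103),
scalar, massless), at block offset `τ ∈ (Fin n)^d`, IN FACTORISED FORM: `Hm n τ = G n 1 0 τ · (1 + Δ^{eff}_n)` — the soft column of
B4 (2.48) at `a = 1`, `m² = 0` times one plus the effective Laplacian (push-through identity; dictionaries below). -/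
def Hm (n : ℕ) [NeZero n] (τ : Fin d → Fin n) (p : Fin d → ℂ) : ℂ := G n 1 0 τ p * (1 + Leff n p)

/-- [folklore] `1 + Δ^{eff} = E(1,0)∕(E(1,0) − Δ^ξ)` wherever the regrouped bracket does not vanish. -/
theorem one_add_Leff_eq (n : ℕ) [NeZero n] (p : Fin d → ℂ) (hF : E n 1 0 p - DeltaXi n 0 p ≠ 0) :
    1 + Leff n p = E n 1 0 p / (E n 1 0 p - DeltaXi n 0 p) := by
  unfold Leff
  field_simp
  ring

/-- [folklore] **DICTIONARY 1 — THE HARD COLUMN AS THE REGROUPED ALIAS SUM**: wherever `E n 1 0 p ≠ 0` and `E n 1 0 p − Δ^ξ(p) ≠ 0`,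
`Hm n τ p = Σ_k F n τ k p · R n 0 k p ∕ (E n 1 0 p − Δ^ξ(p))` — B4's regrouped numerators over the HARD denominator
`E(1,0) − Δ^ξ = U_0 + Σ_{k≠0} U_k·Δ^ξ∕Δ^ξ(·+2πk)` (= `ConstrainedBiLaplacianStrip.den n 1`, the `a → ∞` limit of `E∕a`). -/
theorem Hm_eq_sum (n : ℕ) [NeZero n] (τ : Fin d → Fin n) (p : Fin d → ℂ) (hE : E n 1 0 p ≠ 0)
    (hF : E n 1 0 p - DeltaXi n 0 p ≠ 0) :
    Hm n τ p = ∑ k : Fin d → Fin n, F n τ k p * R n 0 k p / (E n 1 0 p - DeltaXi n 0 p) := by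
  unfold Hm
  rw [one_add_Leff_eq n p hF, G_eq_sum, Finset.sum_mul]
  refine Finset.sum_congr rfl fun k _ => ?_
  field_simp

/-- [folklore] **DICTIONARY 2 — THE PRINTED FORM `𝒢Q*(Q𝒢Q*)⁻¹` ALIAS BY ALIAS**: wherever in addition `Δ^ξ(p′) ≠ 0` and the alias
sum `Σ_j U_j∕Δ^ξ(p′+2πj)` does not vanish (both automatic on the punctured real zone), `Hm n τ p = Σ_k [F n τ k p ∕ Δ^ξ(p′+2πk)] ∕ [Σ_j U n j p ∕ Δ^ξ(p′+2πj)]` — numerator `e^{i(p′+2πk)·τ∕n}u(p′+2πk)∕Δ^ξ(p′+2πk)`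
(the column of `𝒢Q*`), denominator the alias sum `(Q𝒢Q*)^(p′)` (B5 (1.103) with `G = 𝒢` massless, scalar; B4 (2.48) at `a = ∞`). -/
theorem Hm_eq_printed (n : ℕ) [NeZero n] (τ : Fin d → Fin n) (p : Fin d → ℂ) (hE : E n 1 0 p ≠ 0)
    (h0 : DeltaXi n 0 p ≠ 0)
    (hS : ∑ j : Fin d → Fin n, U n j p / DeltaXi n 0 (shift n j p) ≠ 0) :
    Hm n τ p = ∑ k : Fin d → Fin n, (F n τ k p / DeltaXi n 0 (shift n k p))
      / ∑ j : Fin d → Fin n, U n j p / DeltaXi n 0 (shift n j p) := by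
  have hFq : E n 1 0 p - DeltaXi n 0 p = DeltaXi n 0 p * ∑ j : Fin d → Fin n, U n j p / DeltaXi n 0 (shift n j p) :=
    CoarseCovarianceSymbol.F_eq_DeltaXi_mul n p h0
  have hF : E n 1 0 p - DeltaXi n 0 p ≠ 0 := by rw [hFq]; exact mul_ne_zero h0 hS
  rw [Hm_eq_sum n τ p hE hF, hFq]
  refine Finset.sum_congr rfl fun k _ => ?_
  have hRk : R n 0 k p = DeltaXi n 0 p / DeltaXi n 0 (shift n k p) := by
    unfold R
    split_ifs with hk0
    · rw [hk0, shift_zero, div_self h0]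
    · rfl
  rw [hRk]
  field_simp

/-! ## §2 The sub-cell average of the finer column and the exact splitting of the difference -/

/-- [folklore] **THE SUB-CELL AVERAGE OF THE FINER HARD COLUMN** over the `L^d` finer sites inside the coarse fine cell `τ`:
`avgHm = (L^d)⁻¹ Σ_ρ Hm (n·L) (Tsub τ ρ)`. -/
def avgHm (n L : ℕ) [NeZero n] [NeZero L] (τ : Fin d → Fin n) (p : Fin d → ℂ) : ℂ :=
  ((L : ℂ) ^ d)⁻¹ * ∑ ρ : Fin d → Fin L, Hm (n * L) (Tsub n L τ ρ) p

/-- [folklore] the effective-Laplacian factor does not see the fine offset: `avgHm = avgG(n,L;1,0) · (1 + Leff (n·L))`. -/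
theorem avgHm_eq (n L : ℕ) [NeZero n] [NeZero L] (τ : Fin d → Fin n) (p : Fin d → ℂ) :
    avgHm n L τ p = avgG n L 1 0 τ p * (1 + Leff (n * L) p) := by
  unfold avgHm avgG Hm
  rw [← Finset.sum_mul]
  ring

/-- [folklore] THE DIFFERENCE MULTIPLIER of the hard column: sub-cell-averaged finer minus coarser. -/
def DmultH (n L : ℕ) [NeZero n] [NeZero L] (τ : Fin d → Fin n) (p : Fin d → ℂ) : ℂ :=
  avgHm n L τ p - Hm n τ p

/-- [folklore] **THE EXACT SPLITTING**: `avgHm − Hm = Dmult(n,L;1,0)·(1 + Leff(nL)) + G(n;1,0)·(Leff(nL) − Leff(n))`. -/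
theorem DmultH_eq (n L : ℕ) [NeZero n] [NeZero L] (τ : Fin d → Fin n) (p : Fin d → ℂ) :
    DmultH n L τ p = Dmult n L 1 0 τ p * (1 + Leff (n * L) p) + G n 1 0 τ p * (Leff (n * L) p - Leff n p) := by
  unfold DmultH Dmult
  rw [avgHm_eq]
  unfold Hm
  ring

/-! ## §3 The bounds on the fat region -/

/-- [folklore] `‖Δ^{eff}_n(p)‖ ≤ 16d∕c_F` on the fat region, given `c_F ≤ ‖E(1,0) − Δ^ξ‖` (`‖Δ^ξ‖ ≤ 16d`, `B4StripCauchy.norm_DeltaXi_le`). -/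
theorem norm_Leff_le (n : ℕ) [NeZero n] {r : ℝ} (hr : r ≤ 1 / 4) {p : Fin d → ℂ} (hp : p ∈ Fat d r) {cF : ℝ} (hcF : 0 < cF)
    (hF : cF ≤ ‖E n 1 0 p - DeltaXi n 0 p‖) : ‖Leff n p‖ ≤ 16 * d / cF := by
  have hn : 1 ≤ n := Nat.pos_of_ne_zero (NeZero.ne n)
  have h1 : ‖DeltaXi n 0 p‖ ≤ 16 * d + 0 := norm_DeltaXi_le n hn 0 le_rfl hr hp
  rw [add_zero] at h1
  unfold Leff
  rw [norm_div]
  calc ‖DeltaXi n 0 p‖ / ‖E n 1 0 p - DeltaXi n 0 p‖ ≤ ‖DeltaXi n 0 p‖ / cF :=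
        div_le_div_of_nonneg_left (norm_nonneg _) hcF hF
    _ ≤ 16 * d / cF := div_le_div_of_nonneg_right h1 hcF.le

/-- [folklore] `‖1 + Δ^{eff}_n(p)‖ ≤ 1 + 16d∕c_F` on the fat region. -/
theorem norm_one_add_Leff_le (n : ℕ) [NeZero n] {r : ℝ} (hr : r ≤ 1 / 4) {p : Fin d → ℂ} (hp : p ∈ Fat d r) {cF : ℝ}
    (hcF : 0 < cF) (hF : cF ≤ ‖E n 1 0 p - DeltaXi n 0 p‖) : ‖1 + Leff n p‖ ≤ 1 + 16 * d / cF := by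
  have h := norm_Leff_le n hr hp hcF hF
  refine (norm_add_le _ _).trans ?_
  rw [norm_one]
  linarith

/-- [folklore] the constant of `‖Leff(nL) − Leff(n)‖`, given the common lower bound `c_F` of the hard denominators at the two levels. -/
def CL (d L : ℕ) (cF : ℝ) : ℝ := 512 * (d : ℝ) / cF + 16 * (d : ℝ) * (CE d L 1 0 + 512 * (d : ℝ)) / cF ^ 2

/-- [folklore] `CL ≥ 0`. -/
theorem CL_nonneg (d L : ℕ) {cF : ℝ} (hcF : 0 < cF) : 0 ≤ CL d L cF := by
  have := CE_nonneg d L (zero_le_one) (le_refl (0 : ℝ))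
  unfold CL; positivity

/-- [folklore] **THE EFFECTIVE LAPLACIANS OF CONSECUTIVE LEVELS AGREE TO SECOND ORDER**: on the fat region (`r ≤ 1∕4`, `d·r² ≤ 1∕16`),
given `c_F ≤ ‖E n 1 0 p − Δ^ξ_n(p)‖` and `c_F ≤ ‖E (nL) 1 0 p − Δ^{ξ∕L}(p)‖`: `‖Leff (n·L) p − Leff n p‖ ≤ CL∕n²`. -/
theorem norm_Leff_sub_le (n L : ℕ) [NeZero n] [NeZero L] {r : ℝ} (hr : r ≤ 1 / 4) (hdr : (d : ℝ) * r ^ 2 ≤ 1 / 16)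
    {p : Fin d → ℂ} (hp : p ∈ Fat d r) {cF : ℝ} (hcF : 0 < cF) (hF : cF ≤ ‖E n 1 0 p - DeltaXi n 0 p‖)
    (hF' : cF ≤ ‖E (n * L) 1 0 p - DeltaXi (n * L) 0 p‖) :
    ‖Leff (n * L) p - Leff n p‖ ≤ CL d L cF / (n : ℝ) ^ 2 := by
  have hn : 1 ≤ n := Nat.pos_of_ne_zero (NeZero.ne n)
  have hn0 : (0 : ℝ) < n := by exact_mod_cast hn
  set Δ0 := DeltaXi n 0 p with hΔ0
  set Δ1 := DeltaXi (n * L) 0 p with hΔ1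
  set Fq := E n 1 0 p - DeltaXi n 0 p with hFq
  set Fq' := E (n * L) 1 0 p - DeltaXi (n * L) 0 p with hFq'
  have hFq0 : Fq ≠ 0 := norm_pos_iff.mp (hcF.trans_le hF)
  have hFq0' : Fq' ≠ 0 := norm_pos_iff.mp (hcF.trans_le hF')
  have e : Leff (n * L) p - Leff n p = (Δ1 - Δ0) / Fq' + Δ0 * (Fq - Fq') / (Fq * Fq') := by
    unfold Leff
    rw [← hΔ0, ← hΔ1, ← hFq, ← hFq']
    field_simp
    ring
  rw [e]
  have h1 : ‖Δ1 - Δ0‖ ≤ 512 * (d : ℝ) / (n : ℝ) ^ 2 := norm_DeltaXi_mul_sub_le n L 0 hr hp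
  have h2 : ‖Δ0‖ ≤ 16 * d + 0 := norm_DeltaXi_le n hn 0 le_rfl hr hp
  rw [add_zero] at h2
  have h3 : ‖Fq - Fq'‖ ≤ (CE d L 1 0 + 512 * (d : ℝ)) / (n : ℝ) ^ 2 := by
    have eF : Fq - Fq' = -(E (n * L) 1 0 p - E n 1 0 p) + (Δ1 - Δ0) := by
      rw [hFq, hFq', hΔ0, hΔ1]; ring
    rw [eF]
    refine (norm_add_le _ _).trans ?_
    rw [norm_neg, add_div]
    exact add_le_add (norm_E_sub_E_le n L 1 0 zero_le_one le_rfl hr hdr hp) h1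
  have t1 : ‖(Δ1 - Δ0) / Fq'‖ ≤ 512 * (d : ℝ) / (n : ℝ) ^ 2 / cF := by
    rw [norm_div]
    calc ‖Δ1 - Δ0‖ / ‖Fq'‖ ≤ ‖Δ1 - Δ0‖ / cF := div_le_div_of_nonneg_left (norm_nonneg _) hcF hF'
      _ ≤ 512 * (d : ℝ) / (n : ℝ) ^ 2 / cF := div_le_div_of_nonneg_right h1 hcF.le
  have t2 : ‖Δ0 * (Fq - Fq') / (Fq * Fq')‖ ≤ 16 * d * ((CE d L 1 0 + 512 * (d : ℝ)) / (n : ℝ) ^ 2) / (cF * cF) := by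
    rw [norm_div, norm_mul, norm_mul]
    calc ‖Δ0‖ * ‖Fq - Fq'‖ / (‖Fq‖ * ‖Fq'‖) ≤ ‖Δ0‖ * ‖Fq - Fq'‖ / (cF * cF) :=
          div_le_div_of_nonneg_left (by positivity) (by positivity) (mul_le_mul hF hF' hcF.le (norm_nonneg _))
      _ ≤ 16 * d * ((CE d L 1 0 + 512 * (d : ℝ)) / (n : ℝ) ^ 2) / (cF * cF) :=
          div_le_div_of_nonneg_right (mul_le_mul h2 h3 (norm_nonneg _) (by positivity)) (by positivity)
  calc ‖(Δ1 - Δ0) / Fq' + Δ0 * (Fq - Fq') / (Fq * Fq')‖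
      ≤ ‖(Δ1 - Δ0) / Fq'‖ + ‖Δ0 * (Fq - Fq') / (Fq * Fq')‖ := norm_add_le _ _
    _ ≤ 512 * (d : ℝ) / (n : ℝ) ^ 2 / cF + 16 * d * ((CE d L 1 0 + 512 * (d : ℝ)) / (n : ℝ) ^ 2) / (cF * cF) :=
        add_le_add t1 t2
    _ = CL d L cF / (n : ℝ) ^ 2 := by unfold CL; field_simp

/-- [folklore] the constant of the hard difference multiplier in the ENTRYWISE currency (weight `HF(n) ≍ (48 log n)^d`). -/
def CH (n d L : ℕ) (c cF : ℝ) : ℝ := HF n d * Ccol d L 1 0 c * (1 + 16 * (d : ℝ) / cF) + boundG d c 0 * CL d L cF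

/-- [folklore] `CH ≥ 0`. -/
theorem CH_nonneg (n d L : ℕ) {c cF : ℝ} (hc : 0 < c) (hcF : 0 < cF) : 0 ≤ CH n d L c cF := by
  have h1 := HF_nonneg n d
  have h2 := Ccol_nonneg d L (zero_le_one) (le_refl (0 : ℝ)) hc
  have h3 := boundG_nonneg d hc (le_refl (0 : ℝ))
  have h4 := CL_nonneg d L hcF
  unfold CH; positivity

/-- [folklore] **THE HARD COLUMN DIFFERENCE IS `O(n⁻²)` ON THE FAT REGION** (`0 < d`, `r ≤ 1∕4`, `d·r² ≤ 1∕16`): given `c ≤ ‖E n 1 0 p‖`,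
`c ≤ ‖E (nL) 1 0 p‖` (soft denominators) and `c_F ≤ ‖E n 1 0 p − Δ^ξ_n‖`, `c_F ≤ ‖E (nL) 1 0 p − Δ^{ξ∕L}‖` (hard denominators),
`‖avgHm n L τ p − Hm n τ p‖ ≤ CH(n)∕n²` for EVERY coarse fine offset `τ`. -/
theorem norm_DmultH_le (n L : ℕ) [NeZero n] [NeZero L] (hd : 0 < d) {r : ℝ} (hr : r ≤ 1 / 4) (hdr : (d : ℝ) * r ^ 2 ≤ 1 / 16)
    {p : Fin d → ℂ} (hp : p ∈ Fat d r) {c cF : ℝ} (hc : 0 < c) (hcF : 0 < cF) (hcE : c ≤ ‖E n 1 0 p‖)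
    (hcE' : c ≤ ‖E (n * L) 1 0 p‖) (hF : cF ≤ ‖E n 1 0 p - DeltaXi n 0 p‖)
    (hF' : cF ≤ ‖E (n * L) 1 0 p - DeltaXi (n * L) 0 p‖) (τ : Fin d → Fin n) :
    ‖DmultH n L τ p‖ ≤ CH n d L c cF / (n : ℝ) ^ 2 := by
  have hn0 : (0 : ℝ) < n := by exact_mod_cast Nat.pos_of_ne_zero (NeZero.ne n)
  rw [DmultH_eq]
  have h1 := norm_Dmult_le n L 1 0 zero_le_one le_rfl hr hdr hp hc hcE hcE' τ
  have h2 := norm_one_add_Leff_le (n * L) hr hp hcF hF'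
  have h3 := norm_G_le n hd 1 0 0 le_rfl le_rfl hr hdr hp hc hcE τ
  have h4 := norm_Leff_sub_le n L hr hdr hp hcF hF hF'
  have hHC : 0 ≤ HF n d * Ccol d L 1 0 c / (n : ℝ) ^ 2 :=
    div_nonneg (mul_nonneg (HF_nonneg n d) (Ccol_nonneg d L zero_le_one le_rfl hc)) (sq_nonneg _)
  have hBG : 0 ≤ boundG d c 0 := boundG_nonneg d hc le_rfl
  calc ‖Dmult n L 1 0 τ p * (1 + Leff (n * L) p) + G n 1 0 τ p * (Leff (n * L) p - Leff n p)‖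
      ≤ ‖Dmult n L 1 0 τ p‖ * ‖1 + Leff (n * L) p‖ + ‖G n 1 0 τ p‖ * ‖Leff (n * L) p - Leff n p‖ := by
        refine (norm_add_le _ _).trans ?_; rw [norm_mul, norm_mul]
    _ ≤ (HF n d * Ccol d L 1 0 c / (n : ℝ) ^ 2) * (1 + 16 * (d : ℝ) / cF) + boundG d c 0 * (CL d L cF / (n : ℝ) ^ 2) :=
        add_le_add (mul_le_mul h1 h2 (norm_nonneg _) hHC) (mul_le_mul h3 h4 (norm_nonneg _) hBG)
    _ = CH n d L c cF / (n : ℝ) ^ 2 := by unfold CH; field_simp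

end Summit.QuantumFields.BalabanUV.Beta.GAN24.SubAveragingMinimiser
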